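import Literature.AlgebraicGeometry.AbelianSchemes.SymplecticLevelDatumTransfer
import Literature.AlgebraicGeometry.AbelianSchemes.SymplecticLiftOfFiniteLevels
import Literature.AlgebraicGeometry.AbelianSchemes.PolarizedAbelianSchemeWithLevelBaseChange
import HarnessLib

/-!
# Symplectic lifts and single-level symplectic data at a geometric point of a base change `A ×_S S′`
# ([Lan2013PELCompactifications] Lemma 1.3.6.5 / 1.3.6.6; [MumfordFogartyKirwan1994] Ch. 7 §2 Def. 7.2)

Cell `hodgecm-mathlib`, F-DAG (h9-S) (W3c) plumbing (B-p13 (g19) under B-p11 (g16)'s W3 lead): ★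
`SymplecticLevelDatumTransfer` (single-level (T0ₘ)/(T1ₘ)/(T1ₘ⁻¹)/(T2ₘ) along an arbitrary isomorphism of fibre abelian
varieties) SPECIALISED to the fibre identification of a base change, `e := A.fibreBaseChangeIso g t :
(A ×_S S′)_t ≅ A_{t ≫ g}` (★ `AbelianSchemeBaseChangeComp`), whose marks hypothesis is ★
`LevelStructure.map_fibreBaseChangeIso_restrictPt_baseChange_σ` (`e(σ′ᵢ(t)) = σᵢ(t ≫ g)` for `φ′ := φ.baseChange g`) and
whose transferred witness is ★ `divisorBaseChange g t Θ = e^*Θ`.  This is the currency the (W3c) assembly runs in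
(`g := b₀ : B₀ → S` a connected finite étale cover trivialising the level-`kN` torsion, `t := t₀, t₁`):

* `LevelStructure.nonempty_symplecticLift_baseChange_iff` — `Nonempty (φ.SymplecticLift (t ≫ g) Θ δ) ↔
  Nonempty ((φ.baseChange g).SymplecticLift t (divisorBaseChange g t Θ) δ)` (towers);
* `LevelStructure.exists_level_baseChange_iff` — the same for a SINGLE level `kN` in the literal (S1) datum shape;
* `LevelStructure.exists_level_baseChange_of_symplecticLift` (t₀ side: a lift `Λ₀` of `φ` at `t₀ ≫ g` gives level-`kN`
  data on `(A ×_S S′)_{t₀}` for every `k ≠ 0`, ★ (S1 ⇒) + (T1ₖ));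
* `LevelStructure.nonempty_symplecticLift_of_forall_level_baseChange` (t₁ side: level-`kN` data on `(A ×_S S′)_{t₁}`
  for `e^*Θ₁` at every `k ≠ 0` give a lift of `φ` at `t₁ ≫ g` for `Θ₁`, (T1ₖ⁻¹) + ★ (S1 ⇐) König).

Theorems only; no definition, no named fact, no instance, no `sorry`.  HC_CM is proved only modulo the 7 printed
citations until rung 0 closes; count-neutral capital for F-6 (V′).

## References
* [Lan2013PELCompactifications] K.-W. Lan, *Arithmetic compactifications of PEL-type Shimura varieties* (2013), §1.3.6
  Lemma 1.3.6.5 (p. 81), Lemma 1.3.6.6 and Cor. 1.3.6.7 (pp. 81–82).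
* [MumfordFogartyKirwan1994] D. Mumford, J. Fogarty, F. Kirwan, *Geometric Invariant Theory*, 3rd ed., Ch. 7 §2
  Def. 7.2 (p. 129) (the moduli functor by pull-back).
* [MumfordAV1970] D. Mumford, *Abelian Varieties* (1970), §20, property (3) of `e_n` (p. 186).
-/

noncomputable section

universe u

open CategoryTheory CategoryTheory.Limits AlgebraicGeometry

namespace Literature.AlgebraicGeometry.AbelianSchemes

namespace AbelianSchemeOver

open Literature.AlgebraicGeometry.Motives
open scoped MonObj

variable {S S' : Scheme.{u}} {A : AbelianSchemeOver S} {g N : ℕ} (φ : A.LevelStructure g N) (b : S' ⟶ S)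
  {Ω : Type u} [Field Ω] (t : Spec (.of Ω) ⟶ S') (Θ : CartierDivisor (A.fibre (t ≫ b)).toAbelianVariety.X.left)
  (δ : Fin g → ℕ)

/-- **Symplectic lifts of `φ` at `t ≫ b` for `Θ` ↔ symplectic lifts of `φ ×_S S′` at `t` for `e^*Θ`**, `e` the fibre
identification `(A ×_S S′)_t ≅ A_{t ≫ b}` — ★ `nonempty_symplecticLift_transport_iff` at `e := fibreBaseChangeIso`,
marks by ★ `map_fibreBaseChangeIso_restrictPt_baseChange_σ`.
[cite: Lan2013PELCompactifications, §1.3.6 Lemma 1.3.6.5 (p. 81) and Lemma 1.3.6.6 (pp. 81–82)]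
[cite: MumfordFogartyKirwan1994, Ch. 7 §2 Definition 7.2 (p. 129)] -/
theorem LevelStructure.nonempty_symplecticLift_baseChange_iff :
    Nonempty (φ.SymplecticLift (t ≫ b) Θ δ) ↔
      Nonempty ((φ.baseChange b).SymplecticLift t (A.divisorBaseChange b t Θ) δ) :=
  LevelStructure.nonempty_symplecticLift_transport_iff (φ := φ) (φ' := φ.baseChange b) (A.fibreBaseChangeIso b t)
    (φ.map_fibreBaseChangeIso_restrictPt_baseChange_σ A b t) Θ

/-- **Single-level symplectic data of `φ` at `t ≫ b` for `Θ` ↔ single-level data of `φ ×_S S′` at `t` for `e^*Θ`**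
(level `kN`, literal (S1) shape) — ★ (T1ₖ)/(T1ₖ⁻¹) at `e := fibreBaseChangeIso`.
[cite: Lan2013PELCompactifications, §1.3.6 Lemma 1.3.6.5 (p. 81) and Lemma 1.3.6.6 (pp. 81–82)]
[cite: MumfordAV1970, §20 (property (3) of e_n, p. 186)] -/
theorem LevelStructure.exists_level_baseChange_iff {k : ℕ} :
    (∃ (ζ : Ω) (L : Multiplicative (Fin g ⊕ Fin g → ZMod (k * N)) →*
          (A.fibre (t ≫ b)).toAbelianVariety.torsionPoints Ω ((k * N : ℕ) : ℤ)),
        IsPrimitiveRoot ζ (k * N) ∧ Function.Bijective L ∧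
        (∀ i : Fin g ⊕ Fin g,
          ((L (Multiplicative.ofAdd (Pi.single i 1))) : (A.fibre (t ≫ b)).toAbelianVariety.Points Ω) ^ k =
            A.restrictPt (t ≫ b) (φ.σ i)) ∧
        ∀ (hMΩ : ((k * N : ℕ) : Ω) ≠ 0) (x y : Fin g ⊕ Fin g → ZMod (k * N)),
          haveI := AbelianVariety.isDominant_toSchemeHom_zsmul_of_ne_zero (A.fibre (t ≫ b)).toAbelianVariety hMΩ
          (A.fibre (t ≫ b)).toAbelianVariety.weilPairingLevel Θ (L (Multiplicative.ofAdd x))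
              (L (Multiplicative.ofAdd y)) = ζ ^ (typeFormMod δ (k * N) x y).val) ↔
    ∃ (ζ : Ω) (L' : Multiplicative (Fin g ⊕ Fin g → ZMod (k * N)) →*
        ((A.baseChange b).fibre t).toAbelianVariety.torsionPoints Ω ((k * N : ℕ) : ℤ)),
      IsPrimitiveRoot ζ (k * N) ∧ Function.Bijective L' ∧
      (∀ i : Fin g ⊕ Fin g,
        ((L' (Multiplicative.ofAdd (Pi.single i 1))) : ((A.baseChange b).fibre t).toAbelianVariety.Points Ω) ^ k =
          (A.baseChange b).restrictPt t ((φ.baseChange b).σ i)) ∧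
      ∀ (hMΩ : ((k * N : ℕ) : Ω) ≠ 0) (x y : Fin g ⊕ Fin g → ZMod (k * N)),
        haveI := AbelianVariety.isDominant_toSchemeHom_zsmul_of_ne_zero ((A.baseChange b).fibre t).toAbelianVariety hMΩ
        ((A.baseChange b).fibre t).toAbelianVariety.weilPairingLevel (A.divisorBaseChange b t Θ)
            (L' (Multiplicative.ofAdd x)) (L' (Multiplicative.ofAdd y)) = ζ ^ (typeFormMod δ (k * N) x y).val :=
  ⟨LevelStructure.exists_level_transport (φ := φ) (φ' := φ.baseChange b) (A.fibreBaseChangeIso b t)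
      (φ.map_fibreBaseChangeIso_restrictPt_baseChange_σ A b t) Θ,
    LevelStructure.exists_level_of_transport (φ := φ) (φ' := φ.baseChange b) (A.fibreBaseChangeIso b t)
      (φ.map_fibreBaseChangeIso_restrictPt_baseChange_σ A b t) Θ⟩

/-- **(t₀ side) A symplectic lift `Λ₀` of `φ` at `t ≫ b` for `Θ` yields, at EVERY level `kN` (`k ≠ 0`), a single-level
symplectic datum of `φ ×_S S′` at `t` for `e^*Θ`** — ★ (S1 ⇒) forgets the tower to the level `kN`, then (T1ₖ).
[cite: Lan2013PELCompactifications, §1.3.6 Lemma 1.3.6.5 (p. 81) and Lemma 1.3.6.6 (pp. 81–82)]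
[cite: MumfordFogartyKirwan1994, Ch. 7 §2 Definition 7.2 (p. 129)] -/
theorem LevelStructure.exists_level_baseChange_of_symplecticLift (hN : N ≠ 0) (Λ : φ.SymplecticLift (t ≫ b) Θ δ)
    {k : ℕ} (hk : k ≠ 0) :
    ∃ (ζ : Ω) (L' : Multiplicative (Fin g ⊕ Fin g → ZMod (k * N)) →*
        ((A.baseChange b).fibre t).toAbelianVariety.torsionPoints Ω ((k * N : ℕ) : ℤ)),
      IsPrimitiveRoot ζ (k * N) ∧ Function.Bijective L' ∧
      (∀ i : Fin g ⊕ Fin g,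
        ((L' (Multiplicative.ofAdd (Pi.single i 1))) : ((A.baseChange b).fibre t).toAbelianVariety.Points Ω) ^ k =
          (A.baseChange b).restrictPt t ((φ.baseChange b).σ i)) ∧
      ∀ (hMΩ : ((k * N : ℕ) : Ω) ≠ 0) (x y : Fin g ⊕ Fin g → ZMod (k * N)),
        haveI := AbelianVariety.isDominant_toSchemeHom_zsmul_of_ne_zero ((A.baseChange b).fibre t).toAbelianVariety hMΩ
        ((A.baseChange b).fibre t).toAbelianVariety.weilPairingLevel (A.divisorBaseChange b t Θ)
            (L' (Multiplicative.ofAdd x)) (L' (Multiplicative.ofAdd y)) = ζ ^ (typeFormMod δ (k * N) x y).val :=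
  (φ.exists_level_baseChange_iff b t Θ δ).1
    ((φ.nonempty_symplecticLift_iff_forall_level (t ≫ b) Θ δ hN).1 ⟨Λ⟩ k hk)

/-- **(t₁ side) Single-level symplectic data of `φ ×_S S′` at `t` for `e^*Θ` at EVERY level `kN` yield a symplectic
lift of `φ` at `t ≫ b` for `Θ`** — (T1ₖ⁻¹) at each level, then ★ (S1 ⇐) (König on the cofinal chain of levels).
This is the last step of (W3c): the similitudes produced on the fibre of the finite étale cover at `t₁` by ★
`exists_similitude_transport` are read on `A_{s₁}`, `s₁ = t₁ ≫ b`.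
[cite: Lan2013PELCompactifications, §1.3.6 Lemma 1.3.6.6 and Cor. 1.3.6.7 (pp. 81–82)]
[cite: MumfordFogartyKirwan1994, Ch. 7 §2 Definition 7.2 (p. 129)] -/
theorem LevelStructure.nonempty_symplecticLift_of_forall_level_baseChange (hN : N ≠ 0)
    (h : ∀ k : ℕ, k ≠ 0 → ∃ (ζ : Ω) (L' : Multiplicative (Fin g ⊕ Fin g → ZMod (k * N)) →*
          ((A.baseChange b).fibre t).toAbelianVariety.torsionPoints Ω ((k * N : ℕ) : ℤ)),
        IsPrimitiveRoot ζ (k * N) ∧ Function.Bijective L' ∧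
        (∀ i : Fin g ⊕ Fin g,
          ((L' (Multiplicative.ofAdd (Pi.single i 1))) : ((A.baseChange b).fibre t).toAbelianVariety.Points Ω) ^ k =
            (A.baseChange b).restrictPt t ((φ.baseChange b).σ i)) ∧
        ∀ (hMΩ : ((k * N : ℕ) : Ω) ≠ 0) (x y : Fin g ⊕ Fin g → ZMod (k * N)),
          haveI := AbelianVariety.isDominant_toSchemeHom_zsmul_of_ne_zero ((A.baseChange b).fibre t).toAbelianVariety
            hMΩ
          ((A.baseChange b).fibre t).toAbelianVariety.weilPairingLevel (A.divisorBaseChange b t Θ)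
              (L' (Multiplicative.ofAdd x)) (L' (Multiplicative.ofAdd y)) = ζ ^ (typeFormMod δ (k * N) x y).val) :
    Nonempty (φ.SymplecticLift (t ≫ b) Θ δ) :=
  (φ.nonempty_symplecticLift_iff_forall_level (t ≫ b) Θ δ hN).2 fun k hk =>
    (φ.exists_level_baseChange_iff b t Θ δ).2 (h k hk)

end AbelianSchemeOver

end Literature.AlgebraicGeometry.AbelianSchemes

end
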